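import Mathlib
import HarnessLib

/-!
# The relative algebraic closure in a finitely generated field extension is a finite extension
# (crux `WildQuotients.WildQuotientResolution`, stub `stub_phaseZeroHighDim`: discharge of (H2))

Crux stmt-ResolutionOfSingularities-15640 (`WildQuotientResolution`), registered stub `stub_phaseZeroHighDim`.
The formal census ✓`PhaseZeroReduction.phaseZero_conclusion_of_equivariantRegularModels` derives the stub's
conclusion from (H1) Abbes–Saito 2011 Prop. 2.22, (H2) finiteness of relative normalisation over a field and
(H3) equivariant regular models. This file is the field-theoretic input for DISCHARGING (H2):

**Theorem** (`finiteDimensional_algebraicClosure_of_adjoin_eq_top`). If `E = F(s)` for a finite set `s`,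
then the relative algebraic closure of `F` in `E` is a finite extension of `F`.

Proof: choose a transcendence basis `t ⊆ s` of `E/F`; `t` stays algebraically independent over the
algebraic closure `K` of `F` in `E` (Mathlib `AlgebraicIndependent.algebraicClosure`), so the monomials in
`t` are `K`-linearly independent, i.e. `K` and `F[t]` are linearly disjoint over `F`; hence every
`F`-linearly independent family in `K` is `F[t]`-, hence `F(t)`-linearly independent in `E`, and
`[K : F] ≤ [E : F(t)] < ∞` (`E` is generated over `F(t)` by the finitely many algebraic elements `s`).

[OURS · crux stmt-ResolutionOfSingularities-15640 · helper toward `stub_phaseZeroHighDim` (discharge of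
hypothesis (H2) of the conditional reduction); counted 0; AI-level work, weaker than expert review.]
(classical: Bourbaki, Algèbre V §14 no. 7, Cor. 3) [folklore]
-/

-- single-problem summit: the doubled namespace component `ResolutionOfSingularities` is forced
set_option linter.dupNamespace false

noncomputable section

open Cardinal

namespace Summit.ResolutionOfSingularities.ResolutionOfSingularities.Theorems.WildQuotientResolution.RelAlgClosureFinite

universe u v

open scoped IntermediateField.algebraAdjoinAdjoin

/-- If `t` is algebraically independent over an intermediate field `K` of `E/F`, then every
`F`-linearly independent family in `K` is `F(t)`-linearly independent in `E` (`K` and `F(t)` are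
linearly disjoint over `F`: the monomials in `t`, an `F`-basis of `F[t]`, are `K`-linearly independent).
[folklore] -/
theorem linearIndependent_adjoin_of_algebraicIndependent {F : Type u} {E : Type v} [Field F]
    [Field E] [Algebra F E] (K : IntermediateField F E) {ι : Type*} {t : ι → E}
    (ht : AlgebraicIndependent K t) {κ : Type*} {v : κ → K} (hv : LinearIndependent F v) :
    LinearIndependent (IntermediateField.adjoin F (Set.range t)) (fun i => (v i : E)) := by
  classical
  have htF : AlgebraicIndependent F t := ht.restrictScalars (algebraMap F K).injective
  let B : Subalgebra F E := Algebra.adjoin F (Set.range t)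
  -- the monomials in `t`: an `F`-basis of `B = F[t]` …
  let b : Module.Basis (ι →₀ ℕ) F B :=
    (MvPolynomial.basisMonomials ι F).map htF.aevalEquiv.toLinearEquiv
  -- … which is `K`-linearly independent in `E`
  have hmon : LinearIndependent K ((MvPolynomial.aeval t : MvPolynomial ι K →ₐ[K] E).toLinearMap ∘
      (MvPolynomial.basisMonomials ι K)) :=
    (MvPolynomial.basisMonomials ι K).linearIndependent.map' _
      (LinearMap.ker_eq_bot.mpr (algebraicIndependent_iff_injective_aeval.1 ht))
  have hfun : (B.val ∘ b : (ι →₀ ℕ) → E) =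
      (MvPolynomial.aeval t : MvPolynomial ι K →ₐ[K] E).toLinearMap ∘
        (MvPolynomial.basisMonomials ι K) := by
    funext m
    simp [b, B, MvPolynomial.aeval_monomial]
  have hLD : K.toSubalgebra.LinearDisjoint B :=
    Subalgebra.LinearDisjoint.of_basis_right _ _ b (by rw [hfun]; exact hmon)
  have h1 : LinearIndependent B (fun i => (v i : E)) := hLD.linearIndependent_left_of_flat hv
  exact (LinearIndependent.iff_fractionRing B (IntermediateField.adjoin F (Set.range t))).mp h1

/-- **The relative algebraic closure of `F` in a finitely generated extension `E = F(s)` is finite over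
`F`.** (classical: Bourbaki, Algèbre V §14 no. 7, Cor. 3) [folklore] -/
theorem finiteDimensional_algebraicClosure_of_adjoin_eq_top {F : Type u} {E : Type v} [Field F]
    [Field E] [Algebra F E] (s : Set E) (hs : s.Finite)
    (hsE : IntermediateField.adjoin F s = ⊤) :
    FiniteDimensional F (algebraicClosure F E) := by
  classical
  -- `E` is algebraic over `F[s]`
  haveI : Algebra.IsAlgebraic (IntermediateField.adjoin F s) E := by
    refine ⟨fun x => ?_⟩
    have hx : x ∈ IntermediateField.adjoin F s := by rw [hsE]; trivial
    exact isAlgebraic_algebraMap (⟨x, hx⟩ : IntermediateField.adjoin F s)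
  haveI : Algebra.IsAlgebraic (Algebra.adjoin F s) E :=
    IntermediateField.isAlgebraic_adjoin_iff_top.mp inferInstance
  -- a (finite) transcendence basis `t ⊆ s`
  obtain ⟨t, hts, ht⟩ := exists_isTranscendenceBasis_subset (R := F) s
  haveI : Finite t := (hs.subset hts).to_subtype
  haveI : Algebra.IsAlgebraic (IntermediateField.adjoin F (Set.range ((↑) : t → E))) E :=
    ht.isAlgebraic_field
  -- `E` is finite over `F(t)`
  haveI : FiniteDimensional (IntermediateField.adjoin F (Set.range ((↑) : t → E))) E := by
    haveI : Finite s := hs.to_subtype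
    have h1 : FiniteDimensional (IntermediateField.adjoin F (Set.range ((↑) : t → E)))
        (IntermediateField.adjoin (IntermediateField.adjoin F (Set.range ((↑) : t → E))) s) :=
      IntermediateField.finiteDimensional_adjoin fun x _ =>
        (Algebra.IsAlgebraic.isAlgebraic
          (R := IntermediateField.adjoin F (Set.range ((↑) : t → E))) x).isIntegral
    have h2 : IntermediateField.adjoin (IntermediateField.adjoin F (Set.range ((↑) : t → E))) s
        = ⊤ := by
      rw [← IntermediateField.restrictScalars_eq_top_iff (K := F),
        IntermediateField.adjoin_adjoin_left, eq_top_iff, ← hsE]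
      exact IntermediateField.adjoin.mono _ _ _ Set.subset_union_right
    rw [h2] at h1
    exact IntermediateField.topEquiv.toLinearEquiv.finiteDimensional
  -- `[K : F] ≤ [E : F(t)]`
  have key : Module.rank F (algebraicClosure F E) ≤
      Module.rank (IntermediateField.adjoin F (Set.range ((↑) : t → E))) E := by
    rw [Module.rank_def]
    refine ciSup_le' fun ι => ?_
    have hli : LinearIndependent (IntermediateField.adjoin F (Set.range ((↑) : t → E)))
        (fun x : ι.1 => ((x : algebraicClosure F E) : E)) :=
      linearIndependent_adjoin_of_algebraicIndependent (algebraicClosure F E)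
        ht.1.algebraicClosure ι.2.linearIndependent
    exact hli.cardinal_le_rank
  exact Module.rank_lt_aleph0_iff.mp (key.trans_lt (Module.rank_lt_aleph0 _ E))

end Summit.ResolutionOfSingularities.ResolutionOfSingularities.Theorems.WildQuotientResolution.RelAlgClosureFinite

end
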